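import Mathlib
import HarnessLib
import Summits.NavierStokesRegularity.NavierStokesRegularity.Theorems.TaylorModelRungThreeCertificateIntervalDEnclose

/-!
# Crux K1b-DR (stmt-NavierStokesRegularity-23954), line `taylor-model` — certificate SOUNDNESS tooling: `IntervalD` extras —
# midpoint, approximate dyadic quotient (chosen-object helpers for the frame rule), and the SIGN-SPLIT product `mulS`

Requested by engine-1 g67 (09:27Z) for the square-root-free rounded Gram–Schmidt frame rule of PROPAGATE-V-SPEC-cert1 §2 D (frames are
CHOSEN objects — no inclusion claim is needed for how they are computed): `IntervalD.mid I : Dyad` (exact midpoint `(lo + hi)/2`, with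
`mem_mid` for convenience) and `Dyad.divApprox prec a b` (a `prec`-bit dyadic near `a / b`, floor-rounded; junk `0` for `b = 0`; no claim).
Also the SIGN-SPLIT interval product `IntervalD.mulS` (two dyadic products and sign tests instead of Moore's four products and six aligned
comparisons — MEASURED ×1.8 on the rounded multiply-add in the farm interpreter) with `mem_mulS`, its rounded form `mulSR`/`mem_mulSR`,
and the fused rounded multiply-add `fmaR prec a b c := roundOut (mulS a b + c)` with `mem_fmaR` — drop-in faster primitives for hot loops.

MODEL-lattice bookkeeping only (rung TL-M3, one finite-dimensional model ODE); nothing here concerns the Navier–Stokes equations.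
-/

-- the sub-problem namespace repeats the summit name by design (D-0017)
set_option linter.dupNamespace false

namespace Summit.NavierStokesRegularity.NavierStokesRegularity.Theorems.TaylorModelCert

namespace Dyad

/-- An approximate dyadic quotient `≈ a / b` with a `prec`-bit mantissa (floor of `(a.m · 2^(prec + |b.m|-bits)) / b.m`, then `roundDown`);
junk `0` when `b.m = 0`. A CHOSEN object (frame rule): no inclusion claim. [folklore] -/
def divApprox (prec : ℕ) (a b : Dyad) : Dyad :=
  if b.m = 0 then ⟨0, 0⟩ else
    let s : ℕ := prec + b.m.natAbs.log2 + 1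
    roundDown prec ⟨(a.m * ((2 ^ s : ℕ) : ℤ)) / b.m, a.e - b.e - s⟩

/-- The sign of the mantissa is the sign of the value: `0 ≤ m ↔ 0 ≤ toReal`. [folklore] -/
theorem toReal_nonneg_iff (d : Dyad) : 0 ≤ d.toReal ↔ 0 ≤ d.m := by
  have hp : (0 : ℝ) < (2 : ℝ) ^ d.e := zpow_pos (by norm_num) _
  unfold toReal
  constructor
  · intro h
    have : (0 : ℝ) ≤ d.m := nonneg_of_mul_nonneg_left h hp
    exact_mod_cast this
  · intro h; exact mul_nonneg (by exact_mod_cast h) hp.le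

/-- `toReal ≤ 0 ↔ m ≤ 0`. [folklore] -/
theorem toReal_nonpos_iff (d : Dyad) : d.toReal ≤ 0 ↔ d.m ≤ 0 := by
  have hp : (0 : ℝ) < (2 : ℝ) ^ d.e := zpow_pos (by norm_num) _
  unfold toReal
  constructor
  · intro h
    by_contra hm
    have : (0 : ℝ) < d.m := by exact_mod_cast (not_le.1 hm)
    linarith [mul_pos this hp]
  · intro h; exact mul_nonpos_of_nonpos_of_nonneg (by exact_mod_cast h) hp.le

/-- `0 ≤ m ↔ 0 ≤ toReal` (mantissa form on the left, for rewriting sign tests). [folklore] -/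
theorem m_nonneg_iff (d : Dyad) : 0 ≤ d.m ↔ 0 ≤ d.toReal := (toReal_nonneg_iff d).symm

/-- `m ≤ 0 ↔ toReal ≤ 0`. [folklore] -/
theorem m_nonpos_iff (d : Dyad) : d.m ≤ 0 ↔ d.toReal ≤ 0 := (toReal_nonpos_iff d).symm

end Dyad

namespace IntervalD

variable {x y z : ℝ} {I J L : IntervalD}

/-- The exact midpoint `(lo + hi) / 2` of an interval, as a dyadic number. [folklore] -/
def mid (I : IntervalD) : Dyad := Dyad.shift (Dyad.add I.lo I.hi) (-1)

/-- The midpoint lies in the interval (when the interval is inhabited). [folklore] -/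
theorem mem_mid (hx : mem x I) : mem (mid I).toReal I := by
  have hle : I.lo.toReal ≤ I.hi.toReal := hx.1.trans hx.2
  have hm : (mid I).toReal = (I.lo.toReal + I.hi.toReal) / 2 := by
    simp only [mid, Dyad.toReal_shift, Dyad.toReal_add, zpow_neg, zpow_one]; ring
  rw [mem, hm]; constructor <;> linarith

/-- **Sign-split product** (Moore product by the nine sign cases: two dyadic products in eight cases, `min`/`max` only when both
factors straddle `0`). [folklore] -/
def mulS (I J : IntervalD) : IntervalD :=
  if 0 ≤ I.lo.m then
    if 0 ≤ J.lo.m then ⟨I.lo.mul J.lo, I.hi.mul J.hi⟩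
    else if J.hi.m ≤ 0 then ⟨I.hi.mul J.lo, I.lo.mul J.hi⟩
    else ⟨I.hi.mul J.lo, I.hi.mul J.hi⟩
  else if I.hi.m ≤ 0 then
    if 0 ≤ J.lo.m then ⟨I.lo.mul J.hi, I.hi.mul J.lo⟩
    else if J.hi.m ≤ 0 then ⟨I.hi.mul J.hi, I.lo.mul J.lo⟩
    else ⟨I.lo.mul J.hi, I.lo.mul J.lo⟩
  else
    if 0 ≤ J.lo.m then ⟨I.lo.mul J.hi, I.hi.mul J.hi⟩
    else if J.hi.m ≤ 0 then ⟨I.hi.mul J.lo, I.lo.mul J.lo⟩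
    else ⟨Dyad.min (I.lo.mul J.hi) (I.hi.mul J.lo), Dyad.max (I.lo.mul J.lo) (I.hi.mul J.hi)⟩

/-- **The sign-split product encloses the product.** [folklore] -/
theorem mem_mulS (hx : mem x I) (hy : mem y J) : mem (x * y) (mulS I J) := by
  obtain ⟨h1, h2⟩ := hx
  obtain ⟨h3, h4⟩ := hy
  unfold mulS
  split_ifs with hI hJ hJ' hI' hJ hJ' hJ hJ' <;>
    simp only [Dyad.m_nonneg_iff, Dyad.m_nonpos_iff, not_le] at * <;>
    simp only [mem, Dyad.toReal_mul, Dyad.toReal_min, Dyad.toReal_max]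
  · -- a ≥ 0, c ≥ 0 : [a c, b d]
    have hy0 : 0 ≤ y := hJ.trans h3
    constructor
    · linarith [mul_le_mul_of_nonneg_left h3 hI, mul_le_mul_of_nonneg_right h1 hy0]
    · linarith [mul_le_mul_of_nonneg_right h2 hy0, mul_le_mul_of_nonneg_left h4 ((hI.trans h1).trans h2)]
  · -- a ≥ 0, d ≤ 0 : [b c, a d]
    have hy0 : y ≤ 0 := h4.trans hJ'
    constructor
    · linarith [mul_le_mul_of_nonneg_left h3 ((hI.trans h1).trans h2), mul_le_mul_of_nonpos_right h2 hy0]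
    · linarith [mul_le_mul_of_nonpos_right h1 hy0, mul_le_mul_of_nonneg_left h4 hI]
  · -- a ≥ 0, c < 0 < d : [b c, b d]
    have hx0 : 0 ≤ x := hI.trans h1
    constructor
    · linarith [mul_le_mul_of_nonneg_left h3 hx0, mul_le_mul_of_nonpos_right h2 hJ.le]
    · linarith [mul_le_mul_of_nonneg_left h4 hx0, mul_le_mul_of_nonneg_right h2 hJ'.le]
  · -- b ≤ 0, c ≥ 0 : [a d, b c]
    have hx0 : x ≤ 0 := h2.trans hI'
    have hy0 : 0 ≤ y := hJ.trans h3
    constructor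
    · linarith [mul_le_mul_of_nonpos_left h4 hx0, mul_le_mul_of_nonneg_right h1 (hy0.trans h4)]
    · linarith [mul_le_mul_of_nonpos_left h3 hx0, mul_le_mul_of_nonneg_right h2 hJ]
  · -- b ≤ 0, d ≤ 0 : [b d, a c]
    have hx0 : x ≤ 0 := h2.trans hI'
    have hy0 : y ≤ 0 := h4.trans hJ'
    constructor
    · linarith [mul_le_mul_of_nonpos_right h2 hy0, mul_le_mul_of_nonpos_left h4 hI']
    · linarith [mul_le_mul_of_nonpos_right h1 hy0, mul_le_mul_of_nonpos_left h3 (h1.trans hx0)]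
  · -- b ≤ 0, c < 0 < d : [a d, a c]
    have hx0 : x ≤ 0 := h2.trans hI'
    constructor
    · linarith [mul_le_mul_of_nonpos_left h4 hx0, mul_le_mul_of_nonneg_right h1 hJ'.le]
    · linarith [mul_le_mul_of_nonpos_left h3 hx0, mul_le_mul_of_nonpos_right h1 hJ.le]
  · -- a < 0 < b, c ≥ 0 : [a d, b d]
    have hy0 : 0 ≤ y := hJ.trans h3
    constructor
    · linarith [mul_le_mul_of_nonneg_right h1 hy0, mul_le_mul_of_nonpos_left h4 hI.le]
    · linarith [mul_le_mul_of_nonneg_right h2 hy0, mul_le_mul_of_nonneg_left h4 hI'.le]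
  · -- a < 0 < b, d ≤ 0 : [b c, a c]
    have hy0 : y ≤ 0 := h4.trans hJ'
    constructor
    · linarith [mul_le_mul_of_nonpos_right h2 hy0, mul_le_mul_of_nonneg_left h3 hI'.le]
    · linarith [mul_le_mul_of_nonpos_right h1 hy0, mul_le_mul_of_nonpos_left h3 hI.le]
  · -- both straddle 0 : [min (a d) (b c), max (a c) (b d)]
    rcases le_total 0 y with hy0 | hy0
    · constructor
      · exact (min_le_left _ _).trans (by linarith [mul_le_mul_of_nonpos_left h4 hI.le, mul_le_mul_of_nonneg_right h1 hy0])
      · exact (le_max_right _ _).trans' (by linarith [mul_le_mul_of_nonneg_right h2 hy0, mul_le_mul_of_nonneg_left h4 hI'.le])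
    · constructor
      · exact (min_le_right _ _).trans (by linarith [mul_le_mul_of_nonneg_left h3 hI'.le, mul_le_mul_of_nonpos_right h2 hy0])
      · exact (le_max_left _ _).trans' (by linarith [mul_le_mul_of_nonpos_right h1 hy0, mul_le_mul_of_nonpos_left h3 hI.le])

/-- Rounded sign-split product. [folklore] -/
def mulSR (prec : ℕ) (I J : IntervalD) : IntervalD := roundOut prec (mulS I J)

/-- [folklore] -/
theorem mem_mulSR (prec : ℕ) (hx : mem x I) (hy : mem y J) : mem (x * y) (mulSR prec I J) :=
  mem_roundOut prec (mem_mulS hx hy)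

/-- Fused rounded multiply-add `a · b + c` (ONE outward rounding). [folklore] -/
def fmaR (prec : ℕ) (I J L : IntervalD) : IntervalD := roundOut prec (add (mulS I J) L)

/-- [folklore] -/
theorem mem_fmaR (prec : ℕ) (hx : mem x I) (hy : mem y J) (hz : mem z L) : mem (x * y + z) (fmaR prec I J L) :=
  mem_roundOut prec (mem_add (mem_mulS hx hy) hz)

/-- `2 · 3 ∈ mulS [2,2] [3,3]` and the straddling case, decided by the kernel. [folklore] -/
example : subset (mulS (ofInt 2) (ofInt 3)) (ofInt 6) = true ∧
    subset (mulS ⟨⟨-1, 0⟩, ⟨2, 0⟩⟩ ⟨⟨-3, 0⟩, ⟨1, 0⟩⟩) ⟨⟨-6, 0⟩, ⟨3, 0⟩⟩ = true := by decide +kernel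

end IntervalD

end Summit.NavierStokesRegularity.NavierStokesRegularity.Theorems.TaylorModelCert
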